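import Mathlib
import Summits.ResolutionOfSingularities.ResolutionOfSingularities.Theorems.WildQuotientsWildQuotientResolutionJordanFourThirdTransport
import Summits.ResolutionOfSingularities.ResolutionOfSingularities.Theorems.WildQuotientsWildQuotientResolutionJordanFourHalfTransport

/-!
# V4U pieces 0 and T — the slot substitutions are the identity modulo the vertex ideal `(X a, X b, X c)`

(crux stmt-ResolutionOfSingularities-15640 `WildQuotients.WildQuotientResolution`, line `Sketch`,
sector `|G| = p`; programme V4U of `L/w45c/CHAIN.md` v7.5a, inputs for the radical identities of
the ring bricks H₀ (res-type-087) / H₁ (res-type-036) of lead-1's p505172 («√(ψ⁻¹⟨π^*F₀, T_j⟩) = J₀»,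
`F₀ = {X a, X b, X c}`); `L/w45c/V4U-DESIGN.md` §2/§3 (vertex curves `C₀ = {ρ = β = γ = 0}`,
`C₁ = {s = A = ξ = 0}`). [OURS · L1 W4.5c] — NOT a statement of any manuscript; replaces the role of
no printed item. Prover res-L1-w45c-stub-1.)

Both slot substitutions fix every variable MODULO `𝔪 = (X a, X b, X c)`:
`θ₀ = subst0`: `X b ↦ N ≡ 0`, `X c ↦ c′ ≡ 0`, `X d ↦ d′ ≡ X d`, and `S_N = substN`: `X c ↦ N_c ≡ 0`.
Hence `mk 𝔪 ∘ θ = mk 𝔪` and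
* `comap_subst0_span_vertex : (span {X a, X b, X c}).comap (subst0 k n a b c d p) = span {X a, X b, X c}`,
* `comap_substN_span_vertex : (span {X a, X b, X c}).comap (substN k n b c p) = span {X a, X b, X c}`
(`p ≥ 1`; no characteristic hypothesis) — the contraction step from the chart subring to the
presented cone ring in the radical identities.
-/

-- single-problem summit: the doubled namespace component `ResolutionOfSingularities` is forced
set_option linter.dupNamespace false

noncomputable section

open MvPolynomial

namespace Summit.ResolutionOfSingularities.ResolutionOfSingularities.Theorems.WildQuotientResolution.JordanFour

section Vertex

variable (k : Type) [Field k] (n : ℕ) (a b c d : Fin n) (p : ℕ)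

/-- A `k`-algebra endomorphism that fixes every variable modulo an ideal `𝔪` satisfies
`mk 𝔪 ∘ θ = mk 𝔪`, hence `𝔪.comap θ = 𝔪`. [folklore] -/
theorem comap_eq_of_forall_X_sub_mem (θ : MvPolynomial (Fin n) k →ₐ[k] MvPolynomial (Fin n) k)
    (𝔪 : Ideal (MvPolynomial (Fin n) k)) (h : ∀ i, θ (X i) - X i ∈ 𝔪) : 𝔪.comap θ = 𝔪 := by
  have key : (Ideal.Quotient.mkₐ k 𝔪).comp θ = Ideal.Quotient.mkₐ k 𝔪 := by
    refine MvPolynomial.algHom_ext fun i => ?_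
    change Ideal.Quotient.mk 𝔪 (θ (X i)) = Ideal.Quotient.mk 𝔪 (X i)
    exact Ideal.Quotient.eq.mpr (h i)
  ext f
  have hf := congrArg (fun φ : MvPolynomial (Fin n) k →ₐ[k] MvPolynomial (Fin n) k ⧸ 𝔪 => φ f) key
  simp only [AlgHom.comp_apply, Ideal.Quotient.mkₐ_eq_mk] at hf
  rw [Ideal.mem_comap, ← Ideal.Quotient.eq_zero_iff_mem, ← Ideal.Quotient.eq_zero_iff_mem, hf]

/-- **`θ₀` is the identity modulo the vertex ideal**: `(X a, X b, X c).comap θ₀ = (X a, X b, X c)`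
(`p ≥ 1`). [OURS · L1 W4.5c] -/
theorem comap_subst0_span_vertex (hbc : b ≠ c) (hbd : b ≠ d) (hcd : c ≠ d) (hp : 1 ≤ p) :
    (Ideal.span ({X a, X b, X c} : Set (MvPolynomial (Fin n) k))).comap (subst0 k n a b c d p) =
      Ideal.span ({X a, X b, X c} : Set (MvPolynomial (Fin n) k)) := by
  set 𝔪 := Ideal.span ({X a, X b, X c} : Set (MvPolynomial (Fin n) k)) with h𝔪
  have hXa : (X a : MvPolynomial (Fin n) k) ∈ 𝔪 := Ideal.subset_span (by simp)
  have hXb : (X b : MvPolynomial (Fin n) k) ∈ 𝔪 := Ideal.subset_span (by simp)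
  have hXc : (X c : MvPolynomial (Fin n) k) ∈ 𝔪 := Ideal.subset_span (by simp)
  have hp1 : p - 1 + 1 = p := Nat.sub_add_cancel hp
  refine comap_eq_of_forall_X_sub_mem k n (subst0 k n a b c d p) 𝔪 fun i => ?_
  by_cases hib : i = b
  · rw [hib, subst0_X_b]
    have epow : (X b : MvPolynomial (Fin n) k) ^ p = X b ^ (p - 1) * X b := by
      rw [← pow_succ, hp1]
    have e : (X b ^ (p - 1) * X b - X a ^ (p - 1) * X b - X b : MvPolynomial (Fin n) k) =
        (X b ^ (p - 1) - X a ^ (p - 1) - 1) * X b := by ring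
    rw [epow, e]
    exact 𝔪.mul_mem_left _ hXb
  by_cases hic : i = c
  · rw [hic, subst0_X_c k n a b c d p hbc]
    have e : (C (2⁻¹ : k) * (2 * X c - X b ^ 2 + X a * X b) - X c : MvPolynomial (Fin n) k) =
        (C (2⁻¹ : k) * 2 - 1) * X c + (C (2⁻¹ : k) * (X a - X b)) * X b := by ring
    rw [e]
    exact 𝔪.add_mem (𝔪.mul_mem_left _ hXc) (𝔪.mul_mem_left _ hXb)
  by_cases hid : i = d
  · rw [hid, subst0_X_d k n a b c d p hbd hcd]
    have e : (X d - (C (2⁻¹ : k) * (2 * X c - X b ^ 2 + X a * X b)) * X b -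
        C (6⁻¹ : k) * (X b ^ 3 - 3 * (X a * X b ^ 2) + 2 * (X a ^ 2 * X b)) - X d : MvPolynomial (Fin n) k) =
        (-(C (2⁻¹ : k) * (2 * X c - X b ^ 2 + X a * X b)) -
          C (6⁻¹ : k) * (X b ^ 2 - 3 * (X a * X b) + 2 * X a ^ 2)) * X b := by ring
    rw [e]
    exact 𝔪.mul_mem_left _ hXb
  · rw [subst0_X_of_ne k n a b c d p i hib hic hid, sub_self]
    exact 𝔪.zero_mem

/-- **`S_N` is the identity modulo the vertex ideal**: `(X a, X b, X c).comap S_N = (X a, X b, X c)`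
(`p ≥ 1`). [OURS · L1 W4.5c] -/
theorem comap_substN_span_vertex (hp : 1 ≤ p) :
    (Ideal.span ({X a, X b, X c} : Set (MvPolynomial (Fin n) k))).comap (substN k n b c p) =
      Ideal.span ({X a, X b, X c} : Set (MvPolynomial (Fin n) k)) := by
  set 𝔪 := Ideal.span ({X a, X b, X c} : Set (MvPolynomial (Fin n) k)) with h𝔪
  have hXc : (X c : MvPolynomial (Fin n) k) ∈ 𝔪 := Ideal.subset_span (by simp)
  have hp1 : p - 1 + 1 = p := Nat.sub_add_cancel hp
  refine comap_eq_of_forall_X_sub_mem k n (substN k n b c p) 𝔪 fun i => ?_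
  by_cases hic : i = c
  · rw [hic, substN_X_self]
    have epow : (X c : MvPolynomial (Fin n) k) ^ p = X c ^ (p - 1) * X c := by
      rw [← pow_succ, hp1]
    have e : (X c ^ (p - 1) * X c - X b ^ (p - 1) * X c - X c : MvPolynomial (Fin n) k) =
        (X c ^ (p - 1) - X b ^ (p - 1) - 1) * X c := by ring
    rw [epow, e]
    exact 𝔪.mul_mem_left _ hXc
  · rw [substN_X_of_ne k n b c p hic, sub_self]
    exact 𝔪.zero_mem

end Vertex

end Summit.ResolutionOfSingularities.ResolutionOfSingularities.Theorems.WildQuotientResolution.JordanFour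

end
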